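import Summits.ABC.IUTFork.Conditional.AbcOfSHwindowFreyRefutationP6Tier2
import Literature.NumberTheory.EllipticCurves.RationalTwoTorsionModPIrreducibleProofs
import HarnessLib

/-!
# R-W row «C:HSHW-REF-P6-TIER2», part 2 (generic): (P6) = `Cor22.CondP6 (ratPoint (A/(A+B))) l` at EVERY Frey rational point with a core,
# for EVERY prime `l ≥ 7`, modulo the ONE tree named fact `mazurKenku_exists_cyclic_isogeny` — and the four-check certificate wrapper (no fact)

PROOF-ONLY file (no `def`, no new `Prop`, no instance, no notation) of the abc-iut cell (seat abc-iut-W-ref-3, gen 2), sibling of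
`AbcOfSHwindowFreyRefutationP6Tier2.lean` (p478172: the generic chain `FreyRef.condP6_ratPoint_of_irreducible` and the kernel certificates
`FreyRef.condP6_frey1061/463/167`). TAKES NO SIDE on [IUTchIII] Cor. 3.12 or on any author; (P6) is classical arithmetic of one elliptic curve over `ℚ`.

* `imageModLContainsSL2_freyCurve_of_mazurKenku`, **`condP6_ratPoint_of_mazurKenku`**: the Frey–Hellegouarch curve `E_{A,B} : y² = x(x − A)(x + B)`
  (coprime `A, B`, `AB(A+B) ≠ 0`) has irreducible `E[l]` for every prime `l ≥ 5` GRANTED `mazurKenku_exists_cyclic_isogeny` (Mazur 1978 Thm. 1 + Kenku 1982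
  = Silverman *AEC* IX.6 Ex. 6.4; tree theorem `hasIrreducibleModPGaloisRep_freyCurve_of_mazurKenku`, Darmon–Merel 1997 Thm. 2.2 through `X₀(4l)`), hence —
  with the transvection at any odd `r ∣ AB(A+B)`, `l ∤ 2·v_r(AB(A+B))`, and `j ∉ {0, 1728}` — `Cor22.CondP6 (ratPoint (A/(A+B))) l` for EVERY prime `l ≥ 7`:
  the classical input (P4) ⟹ (P6) of [IUTchIV] Cor. 2.2 (ii) (p. 45–46) at ALL such triples at once, with no height threshold `H_K` (cf. the tree's
  `Cor22.FullGaloisImage` / `Cor22.condP6_of_seven_le`); so the R-W table's qualifier «mod (P6)» reads «mod Mazur–Kenku» wherever no kernel certificate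
  has been run (the Kenku `X₀(26)` definition contemplated in ruling C-R57 is NOT needed: the fact is already in the tree, `RationalIsogenyDegrees.lean`).
* `condP6_ratPoint_of_noroot`: the certificate wrapper with NO named fact — (P6) at `λ = A/(A+B)`, `l ≥ 7`, from four decidable checks on `freyIntModel A B`
  (a good prime `p ≠ l`, `p ∤ Δ`, `t² − a_p t + p` rootless mod `l`: Mazur 1978 Prop. 6.3 (1) via `FreyRef.hasIrreducibleModPGaloisRep_freyCurve_of_noroot`;
  an odd `r` with `l ∤ 2·v_r(AB(A+B))`; coprimality; `Cor22.AdmitsCore`) — the recipe behind p478172's three data, for future rows.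

HONEST SCOPE: a named fact discharges nothing in print; refuted-modulo ≠ refuted; typed ≠ proved; no abc claim.
[cite: Mochizuki2012, IUTchIV Cor. 2.2 (ii) proof (P4)–(P6) p. 45–46, Thm. 1.10 p. 22] [cite: Mazur1978, Thm. 1 and §6 Prop. 6.3 (1) p. 153] [cite: Kenku1982]
[cite: SilvermanAEC2009, IX.6 Example 6.4] [cite: DarmonMerel1997, Thm. 2.2] [claim: Mochizuki2012, status: disputed] for every IUT sentence quoted.
-/

noncomputable section

open scoped Classical
open NumberField IsDedekindDomain

namespace Summit.ABC.IUTFork.Conditional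

open Literature.IUT.LogVolume Literature.IUT.LogVolume.Cor22
open Literature.NumberTheory.DiophantineGeometry Literature.NumberTheory.DiophantineGeometry.GenEll
open Literature.NumberTheory.EllipticCurves WeierstrassCurve

namespace FreyRef

/-! ## (P6) at every Frey rational point, for every prime `l ≥ 7`: modulo Mazur–Kenku, and the fact-free certificate wrapper -/

/-- **`SL₂(𝔽_l) ⊆ Im ρ̄_{E,l}` over `ℚ` for EVERY Frey–Hellegouarch curve, modulo Mazur–Kenku**: `E_{A,B}[l]` is irreducible for `l ≥ 5` by the
rational `2`-torsion and the classification of rational cyclic isogenies (`hasIrreducibleModPGaloisRep_freyCurve_of_mazurKenku`; Darmon–Merel 1997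
Thm. 2.2 through `X₀(4l)`), then §2. [cite: DarmonMerel1997, Thm. 2.2] [cite: Mazur1978, Thm. 1] [cite: Kenku1982] [cite: SilvermanAEC2009, IX.6 Example 6.4] -/
theorem imageModLContainsSL2_freyCurve_of_mazurKenku (hMK : mazurKenku_exists_cyclic_isogeny) {A B : ℤ} (hAB : IsCoprime A B)
    (h0 : A * B * (A + B) ≠ 0) {l : ℕ} [Fact l.Prime] (h5 : 5 ≤ l) {r : ℕ} (hr : r.Prime) (hr2 : r ≠ 2) (hrl : r ≠ l)
    (hrd : (r : ℤ) ∣ A * B * (A + B)) (hndvd : ¬ l ∣ 2 * padicValInt r (A * B * (A + B))) :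
    letI : (freyCurve A B).IsElliptic := isElliptic_freyCurve h0
    ({ F := ℚ, W := freyCurve A B } : EllPoint).ImageModLContainsSL2 l :=
  imageModLContainsSL2_freyCurve_of_irreducible hAB h0 (hasIrreducibleModPGaloisRep_freyCurve_of_mazurKenku hMK h0 Fact.out h5)
    hr hr2 hrl hrd hndvd

/-- **(P6) at EVERY Frey rational point `λ = A/(A+B)` with a core, for every prime `l ≥ 7`, modulo Mazur–Kenku** ([IUTchIV] Cor. 2.2 (ii) proof,
(P4) ⟹ (P6) p. 45–46, with NO height threshold `H_K`): for coprime integers `A, B` with `AB(A+B) ≠ 0`, `Cor22.AdmitsCore (ratPoint λ)`, a prime `l ≥ 7`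
and an odd prime `r ≠ l` dividing `AB(A+B)` with `l ∤ 2·v_r(AB(A+B))` (any `r ∥ AB(A+B)` will do), `Cor22.CondP6 (ratPoint λ) l` holds GRANTED the
tree's named fact `mazurKenku_exists_cyclic_isogeny` (Mazur 1978 Thm. 1 + Kenku 1982). [cite: Mochizuki2012, IUTchIV Cor. 2.2 (ii) proof (P4)–(P6) p. 45–46]
[cite: Mazur1978, Thm. 1] [cite: Kenku1982] [cite: SilvermanAEC2009, IX.6 Example 6.4] [claim: Mochizuki2012, status: disputed] -/
theorem condP6_ratPoint_of_mazurKenku (hMK : mazurKenku_exists_cyclic_isogeny) {A B : ℤ} (hAB : IsCoprime A B)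
    (h0 : A * B * (A + B) ≠ 0) {q : ℚ} (hq : ((A : ℤ) : ℚ) / ((A : ℚ) + B) = q) (hcore : Cor22.AdmitsCore (ratPoint q))
    {l : ℕ} (hl : l.Prime) (h7 : 7 ≤ l) {r : ℕ} (hr : r.Prime) (hr2 : r ≠ 2) (hrl : r ≠ l)
    (hrd : (r : ℤ) ∣ A * B * (A + B)) (hndvd : ¬ l ∣ 2 * padicValInt r (A * B * (A + B))) :
    Cor22.CondP6 (ratPoint q) l :=
  condP6_ratPoint_of_irreducible hAB h0 hq hcore hl h7 (hasIrreducibleModPGaloisRep_freyCurve_of_mazurKenku hMK h0 hl (by omega))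
    hr hr2 hrl hrd hndvd

/-- **Certificate wrapper — (P6) at `λ = A/(A+B)` from four decidable checks** (for future data; no named fact): given a good prime `p ∤ Δ(E_{A,B})`,
`p ≠ l`, with `t² − a_p t + p` rootless mod `l` (Mazur's Frobenius certificate, `hasIrreducibleModPGaloisRep_freyCurve_of_noroot`), an odd prime
`r ≠ l` dividing `AB(A+B)` with `l ∤ 2·v_r(AB(A+B))`, coprime `A, B` and `Cor22.AdmitsCore`, the condition `Cor22.CondP6 (ratPoint λ) l` holds for
`l ≥ 7`. [cite: Mazur1978, §6 Prop. 6.3 (1) p. 153] [cite: Mochizuki2012, IUTchIV Cor. 2.2 (ii) proof (P4)–(P6) p. 45–46] [claim: Mochizuki2012, status: disputed] -/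
theorem condP6_ratPoint_of_noroot {A B : ℤ} (hAB : IsCoprime A B) (h0 : A * B * (A + B) ≠ 0) {q : ℚ}
    (hq : ((A : ℤ) : ℚ) / ((A : ℚ) + B) = q) (hcore : Cor22.AdmitsCore (ratPoint q)) (l p : ℕ) [Fact l.Prime] [Fact p.Prime] (h7 : 7 ≤ l)
    (hpl : p ≠ l) (hpΔ : ¬ (p : ℤ) ∣ (freyIntModel A B).Δ)
    (hnoroot : ∀ t : ZMod l, t ^ 2 - (Literature.NumberTheory.Automorphic.frobeniusTrace (freyIntModel A B) p : ZMod l) * t + (p : ZMod l) ≠ 0)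
    {r : ℕ} (hr : r.Prime) (hr2 : r ≠ 2) (hrl : r ≠ l) (hrd : (r : ℤ) ∣ A * B * (A + B)) (hndvd : ¬ l ∣ 2 * padicValInt r (A * B * (A + B))) :
    Cor22.CondP6 (ratPoint q) l :=
  condP6_ratPoint_of_irreducible hAB h0 hq hcore Fact.out h7 (hasIrreducibleModPGaloisRep_freyCurve_of_noroot A B l p hpl hpΔ hnoroot)
    hr hr2 hrl hrd hndvd

end FreyRef

end Summit.ABC.IUTFork.Conditional

end
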